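import Mathlib
import Literature.NumberTheory.LFunctions.MertensTail
import Summits.ValiantsHypothesis.ValiantsHypothesis.Theorems.LiouvilleSarnakAlignedTypeICharactersMod2nBilinearSieveRounding
import HarnessLib

/-!
# Route LiouvilleSarnak — support `AlignedTypeI` (stmt-ValiantsHypothesis-21040), line `characters_mod_2n`:
# scalar lemmas for the assembly (value count of the binary rounding, Mertens on a dyadic exponent range, final numerics)

Three def-free lemmas consumed by `…BilinearSieveAssembly.lean`:
* `card_image_binaryRound_le` — a block map as in `exists_binaryRound s` takes at most `(B+2)·2^(s+1)` values on `[1, 2^B]`;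
* `sum_inv_prime_dyadic_ge` — `Σ_{2^A < p ≤ 2^(2^r A)} 1/p ≥ r log 2 − 1` for `A ≥ 9` (the tree's Mertens tail bound
  `MertensBound.loglog_sub_loglog_le_sum_inv_prime`);
* `bilinear_rhs_le` — the final numerics: under the size relations of the parameters the right side of
  `charSqSum_mul_sq_le_of_blockBounds'` is `≤ L² · ε x²`.

HONEST FRAMING. Bookkeeping only; `AlignedTypeI` is NOT closed here; nothing bears on `VP ≠ VNP` (NOT proved).
-/

set_option linter.dupNamespace false

noncomputable section

namespace Summit.ValiantsHypothesis.ValiantsHypothesis.Theorems.LiouvilleSarnak.AlignedTypeI.CharactersModTwoN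

open Finset
open scoped BigOperators

/-! ## §1 The binary-rounding block map has few values -/

/-- A block map as in `exists_binaryRound s` takes at most `(B+2)·2^(s+1)` values on integers `1 ≤ p ≤ 2^B`. [folklore] -/
theorem card_image_binaryRound_le (s B : ℕ) (V : ℕ → ℕ)
    (hV : ∀ p : ℕ, 1 ≤ p → p ≤ V p ∧ 2 ^ (Nat.log 2 (V p) - s) ∣ V p ∧
      (∀ t : ℕ, p ≤ t → 2 ^ (Nat.log 2 t - s) ∣ t → V p ≤ t) ∧
      2 ^ s * V p ≤ 2 ^ s * p + p ∧ V p ≤ 2 ^ (Nat.log 2 p + 1))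
    (P : Finset ℕ) (hP : ∀ p ∈ P, 1 ≤ p ∧ p ≤ 2 ^ B) :
    (P.image V).card ≤ (B + 2) * 2 ^ (s + 1) := by
  classical
  have hshape := fun p (hp : 1 ≤ p) => binaryRound_value_shape s V hV p hp
  -- inject `v ↦ (⌊log₂ v⌋, v / 2^(⌊log₂ v⌋ - s))` into `range (B+2) × range (2^(s+1))`
  have hinj : Set.InjOn (fun v : ℕ => (Nat.log 2 v, v / 2 ^ (Nat.log 2 v - s))) ((P.image V : Finset ℕ) : Set ℕ) := by
    intro v hv v' hv' h
    simp only [Prod.mk.injEq] at h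
    obtain ⟨p, hp, rfl⟩ := Finset.mem_image.mp (Finset.mem_coe.mp hv)
    obtain ⟨p', hp', rfl⟩ := Finset.mem_image.mp (Finset.mem_coe.mp hv')
    rw [(hshape p (hP p hp).1).1, (hshape p' (hP p' hp').1).1, h.2, h.1]
  have hmaps : ∀ v ∈ P.image V,
      (Nat.log 2 v, v / 2 ^ (Nat.log 2 v - s)) ∈ Finset.range (B + 2) ×ˢ Finset.range (2 ^ (s + 1)) := by
    intro v hv
    obtain ⟨p, hp, rfl⟩ := Finset.mem_image.mp hv
    obtain ⟨-, hm, -, hlog⟩ := hshape p (hP p hp).1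
    rw [Finset.mem_product, Finset.mem_range, Finset.mem_range]
    refine ⟨?_, hm⟩
    have : Nat.log 2 p ≤ B := by
      have h := Nat.log_mono_right (b := 2) (hP p hp).2
      rwa [Nat.log_pow (by norm_num)] at h
    omega
  calc (P.image V).card ≤ (Finset.range (B + 2) ×ˢ Finset.range (2 ^ (s + 1))).card :=
        Finset.card_le_card_of_injOn _ hmaps hinj
    _ = (B + 2) * 2 ^ (s + 1) := by rw [Finset.card_product, Finset.card_range, Finset.card_range]

/-! ## §2 Two scalar lemmas (Mertens on a dyadic range of exponents; the final numerics) -/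

/-- Mertens on `(2^A, 2^(2^r A)]`: `Σ 1/p ≥ r log 2 − 1` for `A ≥ 9` (from the tree's tail bound
`MertensBound.loglog_sub_loglog_le_sum_inv_prime`). [folklore] -/
theorem sum_inv_prime_dyadic_ge (A r : ℕ) (hA : 9 ≤ A) :
    (r : ℝ) * Real.log 2 - 1 ≤ ∑ p ∈ (Finset.Ioc (2 ^ A) (2 ^ (2 ^ r * A))).filter Nat.Prime, (1 : ℝ) / p := by
  have hlog2 : 0 < Real.log 2 := Real.log_pos (by norm_num)
  have hA0 : (0 : ℝ) < A := by exact_mod_cast (show 0 < A by omega)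
  have h2A : (2 : ℝ) ≤ ((2 ^ A : ℕ) : ℝ) := by
    have : 2 ^ 1 ≤ 2 ^ A := Nat.pow_le_pow_right (by norm_num) (by omega)
    exact_mod_cast this
  have hAB : A ≤ 2 ^ r * A := Nat.le_mul_of_pos_left _ (by positivity)
  have hAB' : ((2 ^ A : ℕ) : ℝ) ≤ ((2 ^ (2 ^ r * A) : ℕ) : ℝ) := by
    exact_mod_cast Nat.pow_le_pow_right (by norm_num : 1 ≤ 2) hAB
  have hM := Literature.NumberTheory.LFunctions.MertensBound.loglog_sub_loglog_le_sum_inv_prime h2A hAB'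
  rw [Nat.floor_natCast, Nat.floor_natCast] at hM
  have hlogA : Real.log ((2 ^ A : ℕ) : ℝ) = A * Real.log 2 := by push_cast; rw [Real.log_pow]
  have hlogB : Real.log ((2 ^ (2 ^ r * A) : ℕ) : ℝ) = (2 ^ r * A : ℕ) * Real.log 2 := by
    push_cast; rw [Real.log_pow]; push_cast; ring
  rw [hlogA, hlogB] at hM
  have hll : Real.log (((2 ^ r * A : ℕ) : ℝ) * Real.log 2) - Real.log ((A : ℝ) * Real.log 2) = r * Real.log 2 := by
    rw [← Real.log_div (by positivity) (by positivity)]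
    rw [show ((2 ^ r * A : ℕ) : ℝ) * Real.log 2 / (A * Real.log 2) = 2 ^ r by push_cast; field_simp]
    rw [Real.log_pow]
  have h6 : 6 / ((A : ℝ) * Real.log 2) ≤ 1 := by
    rw [div_le_one (by positivity)]
    have h9 : (9 : ℝ) ≤ A := by exact_mod_cast hA
    have : (0.6931471803 : ℝ) < Real.log 2 := Real.log_two_gt_d9
    nlinarith
  linarith

/-- The final numerics of the assembly, isolated: with the size relations of the parameters, the right side of
`charSqSum_mul_sq_le_of_blockBounds'` is at most `L² · ε x²`. [folklore] -/
theorem bilinear_rhs_le (x q ℓ L R R' Pc ε : ℝ) (hε : 0 < ε) (hε1 : ε ≤ 1) (hx : 0 < x) (_hq : 0 ≤ q) (hℓ : 0 ≤ ℓ)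
    (hPc : 0 ≤ Pc) (hL : 1 ≤ L) (hεL : 48 ≤ ε * L) (hR : 0 ≤ R) (hRL : R ≤ ε / 8 * L) (_hR' : 0 ≤ R')
    (hqR' : 2 * q * R' ≤ x * R) (h2q : 2 * q ≤ ℓ) (hPℓ : Pc ^ 2 ≤ ℓ) (hℓx : 72 * ℓ ^ 2 ≤ ε * x ^ 2)
    (hPx : Pc ^ 2 + 2 * L * Pc ≤ x * L) (hqx : 2 * q ≤ x) :
    3 * (x * R * (x * R + 2 * q * R') + (ℓ + 2 * q) * (ℓ * L ^ 2 + ℓ * L + Pc ^ 2) +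
      (x + 2 * q) * (x * L + Pc ^ 2 + 2 * L * Pc)) ≤ L ^ 2 * (ε * x ^ 2) := by
  have T1 : x * R * (x * R + 2 * q * R') ≤ ε / 32 * x ^ 2 * L ^ 2 := by
    have h1 : x * R ≤ ε / 8 * x * L := by nlinarith
    have h0 : 0 ≤ x * R := by positivity
    calc x * R * (x * R + 2 * q * R') ≤ (x * R) * (x * R + x * R) := by gcongr
      _ = 2 * (x * R) ^ 2 := by ring
      _ ≤ 2 * (ε / 8 * x * L) ^ 2 := by gcongr
      _ = ε / 32 * x ^ 2 * L ^ 2 * ε := by ring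
      _ ≤ ε / 32 * x ^ 2 * L ^ 2 * 1 := by gcongr
      _ = _ := by ring
  have T2 : (ℓ + 2 * q) * (ℓ * L ^ 2 + ℓ * L + Pc ^ 2) ≤ ε / 12 * x ^ 2 * L ^ 2 := by
    have h1 : ℓ + 2 * q ≤ 2 * ℓ := by linarith
    have hℓL : ℓ ≤ ℓ * L := by nlinarith
    have hℓL2 : ℓ * L ≤ ℓ * L ^ 2 := by nlinarith [mul_nonneg hℓ (by linarith : (0 : ℝ) ≤ L)]
    have h2 : ℓ * L ^ 2 + ℓ * L + Pc ^ 2 ≤ 3 * (ℓ * L ^ 2) := by linarith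
    have h0 : 0 ≤ ℓ * L ^ 2 + ℓ * L + Pc ^ 2 := by positivity
    calc (ℓ + 2 * q) * (ℓ * L ^ 2 + ℓ * L + Pc ^ 2) ≤ (2 * ℓ) * (3 * (ℓ * L ^ 2)) := by gcongr
      _ = 6 * ℓ ^ 2 * L ^ 2 := by ring
      _ ≤ 6 * (ε * x ^ 2 / 72) * L ^ 2 := by gcongr; linarith
      _ = ε / 12 * x ^ 2 * L ^ 2 := by ring
  have T3 : (x + 2 * q) * (x * L + Pc ^ 2 + 2 * L * Pc) ≤ ε / 12 * x ^ 2 * L ^ 2 := by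
    have h1 : x + 2 * q ≤ 2 * x := by linarith
    have h0 : 0 ≤ x * L + Pc ^ 2 + 2 * L * Pc := by positivity
    calc (x + 2 * q) * (x * L + Pc ^ 2 + 2 * L * Pc) ≤ (2 * x) * (x * L + x * L) :=
          mul_le_mul h1 (by linarith) h0 (by positivity)
      _ = 4 * x ^ 2 * L := by ring
      _ ≤ 4 * x ^ 2 * L * (ε * L / 48) := by
          have : (1 : ℝ) ≤ ε * L / 48 := by rw [le_div_iff₀ (by norm_num)]; linarith
          have h0 : 0 ≤ 4 * x ^ 2 * L := by positivity
          nlinarith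
      _ = ε / 12 * x ^ 2 * L ^ 2 := by ring
  nlinarith [T1, T2, T3, sq_nonneg x, sq_nonneg L, mul_pos hx hx]

end Summit.ValiantsHypothesis.ValiantsHypothesis.Theorems.LiouvilleSarnak.AlignedTypeI.CharactersModTwoN
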